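import Summits.BirchSwinnertonDyer.BirchSwinnertonDyer.Theorems.Rank2ObservatoryMinimalCert
import Summits.BirchSwinnertonDyer.BirchSwinnertonDyer.Theorems.Rank2ObservatoryKrausMinimality
import Literature.NumberTheory.EllipticCurves.SzpiroLocalDataProofs
import HarnessLib

/-!
# BSD rank ≥ 2 observatory (`b2b-bsdr2`): KRAUS-AT-2 minimality certificates, and the TOTAL
# minimality check of the rank-3 census

HONEST FRAMING: per-curve certified theorems and census instruments; no claim on BSD in rank ≥ 2.

Silverman's simple criterion (no prime `q` with `q¹² ∣ Δ` and `q⁴ ∣ c₄`) is silent for the `924`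
rank-3 rows with `2¹² ∣ Δ` and `2⁴ ∣ c₄` (or `c₄ = 0`). For those the tree already holds the
Tate–Kraus step at `2` (`isMinimalAt_baseChange_int_two_of_kraus`: `2⁸ ∤ c₄` and `2⁸ ∤ c₆ + 64` ⇒
minimal at `2`, `Rank2ObservatoryKrausMinimality`). This file

* combines it with Silverman's criterion AT THE ODD PRIMES (`q¹² ∤ Δ` or `q⁴ ∤ c₄`):
  `isMinimalAt_baseChange_int_of_not_pow_four_dvd_c₄`, `isGloballyMinimal_baseChange_int_of_kraus₄`;
* gives the kernel-decidable certificate check `RNCert.krausCheck` on the landed shape `RNCert`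
  (odd entries checked by `OddEntry.minCheck`, `|Δ| = 2^{k2} ∏ pᵉ`, `2⁸ ∤ |c₄|`, `2⁸ ∤ |c₆ + 64|`),
  its soundness `isGloballyMinimal_of_krausCheck`, rows `Rank3Row.KrausCertified`,
  `Rank3Row.isGloballyMinimal_of_krausCertified` (no hypothesis);
* and the TOTAL one-pass walker `totalMinCheck rows os n xs` over a table `rows` with its ALIGNED
  root-number certificates `os` and one index-sorted, tagged list `xs` of extra certificates
  (`false` = minimality-only, `minCheck`; `true` = Kraus, `krausCheck`; built by `mergeIdx`); a row
  not listed must carry a root-number certificate passing `minCheck` — with soundness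
  `isGloballyMinimal_of_totalMinCheck : … → ∀ r ∈ rows, r.curve.IsGloballyMinimal`. The census
  instance is `Rank2ObservatoryRank3MinimalTotal`.

References: Kraus 1989, Prop. 2 [Kraus1989]; Silverman *AEC* VII.1 Rem. 1.1, VIII.8
[SilvermanAEC2009]; Cremona 1997 §3.2 [CremonaAlgorithms1997].
-/

set_option linter.dupNamespace false
set_option autoImplicit false

open WeierstrassCurve IsDedekindDomain Rat.HeightOneSpectrum Literature Literature.NumberTheory.EllipticCurves
  Literature.NumberTheory.Sieve

namespace Summit.BirchSwinnertonDyer.BirchSwinnertonDyer.Rank2Observatory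

/-! ### Kraus at `2` + Silverman at the odd primes -/

/-- **Minimality criterion, `p⁴ ∤ c₄`** (Silverman AEC VII.1 Rem. 1.1: integral and `ord_p c₄ < 4`
⇒ minimal at `p`), for an integer model at a place of `ℤ`. [cite: SilvermanAEC2009, VII.1 Remark 1.1] -/
theorem isMinimalAt_baseChange_int_of_not_pow_four_dvd_c₄ {v : HeightOneSpectrum ℤ}
    {W₀ : WeierstrassCurve ℤ} (h : ¬ (natGenerator v : ℤ) ^ 4 ∣ W₀.c₄) :
    (W₀.baseChange ℚ).IsMinimalAt v :=
  isMinimalAt_of_lt_valuation_c₄ (isIntegralAt_baseChange_int v W₀)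
    (by rw [baseChange_int_c₄]
        exact (Literature.NumberTheory.EllipticCurves.Rat.exp_lt_valuation_intCast_iff v _ 4).mpr h)

/-- **Global minimality from Kraus's condition at `2` and Silverman's criterion at the odd primes**:
`2⁸ ∤ c₄`, `2⁸ ∤ c₆ + 64`, and every odd prime `q` has `q¹² ∤ Δ` or `q⁴ ∤ c₄` ⇒ `W₀ ⊗ ℚ` is a global
minimal equation (minimal at every place, AEC VIII.8). [cite: SilvermanAEC2009, VII.1 Remark 1.1] -/
theorem isGloballyMinimal_baseChange_int_of_kraus₄ (W₀ : WeierstrassCurve ℤ)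
    (h4 : ¬ (2 : ℤ) ^ 8 ∣ W₀.c₄) (h6 : ¬ (2 : ℤ) ^ 8 ∣ W₀.c₆ + 64)
    (hodd : ∀ q : ℕ, q.Prime → q ≠ 2 → ¬ ((q : ℤ) ^ 12 ∣ W₀.Δ ∧ (q : ℤ) ^ 4 ∣ W₀.c₄)) :
    (W₀.baseChange ℚ).IsGloballyMinimal := by
  refine isGloballyMinimal_of_forall_isMinimalAt_int _ fun v => ?_
  by_cases hv : natGenerator v = 2
  · exact isMinimalAt_baseChange_int_two_of_kraus W₀ h4 h6 hv
  · rcases not_and_or.mp (hodd _ (prime_natGenerator v) hv) with h | h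
    · exact isMinimalAt_baseChange_int_of_not_pow_dvd_Δ h
    · exact isMinimalAt_baseChange_int_of_not_pow_four_dvd_c₄ h

namespace RootNumber

/-- KRAUS certificate check: every listed odd entry passes `OddEntry.minCheck`, `|Δ| = 2^{k2} ∏ pᵉ`
(no other prime divides `Δ`), `2⁸ ∤ |c₄|` and `2⁸ ∤ |c₆ + 64|` (`k4`, `k6` are informational).
[cite: Kraus1989, Prop. 2] -/
def RNCert.krausCheck (W₀ : WeierstrassCurve ℤ) (c : RNCert) : Bool :=
  c.odd.all (OddEntry.minCheck W₀) &&
    decide (W₀.Δ.natAbs = 2 ^ c.k2 * (c.odd.map fun E => E.p ^ E.e).prod) &&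
    decide (¬ 2 ^ 8 ∣ W₀.c₄.natAbs) && decide (¬ 2 ^ 8 ∣ (W₀.c₆ + 64).natAbs)

end RootNumber

open RootNumber

section IntModel

variable {W₀ : WeierstrassCurve ℤ} {c : RNCert}

/-- Every ODD prime factor of `Δ` is listed (Kraus check). [folklore] -/
theorem mem_of_prime_dvd_kraus (hc : c.krausCheck W₀ = true) {p : ℕ} (hp : p.Prime) (hp2 : p ≠ 2)
    (hpd : (p : ℤ) ∣ W₀.Δ) : ∃ E ∈ c.odd, E.minCheck W₀ = true ∧ E.p = p := by
  simp only [RNCert.krausCheck, Bool.and_eq_true, decide_eq_true_eq, List.all_eq_true] at hc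
  obtain ⟨⟨⟨hall, hfac⟩, -⟩, -⟩ := hc
  have h1 : p ∣ W₀.Δ.natAbs := Int.natCast_dvd.mp hpd
  rw [hfac] at h1
  rcases (Nat.Prime.dvd_mul hp).mp h1 with h | h
  · exact absurd ((Nat.prime_dvd_prime_iff_eq hp Nat.prime_two).mp (hp.dvd_of_dvd_pow h)) hp2
  · obtain ⟨a, ha, hpa⟩ := (Prime.dvd_prod_iff hp.prime).mp h
    obtain ⟨E, hE, rfl⟩ := List.mem_map.mp ha
    have hEc := hall E hE
    have hE' : E.p.Prime := by
      simp only [OddEntry.minCheck, Bool.and_eq_true] at hEc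
      exact GoldbachLinnik.prime_of_primeCert hEc.1
    exact ⟨E, hE, hEc, ((Nat.prime_dvd_prime_iff_eq hp hE').mp (hp.dvd_of_dvd_pow hpa)).symm⟩

/-- **Silverman's criterion at every ODD prime** from a Kraus certificate.
[cite: SilvermanAEC2009, VII.1 Remark 1.1] -/
theorem odd_criterion_of_krausCheck (hc : c.krausCheck W₀ = true) :
    ∀ q : ℕ, q.Prime → q ≠ 2 → ¬ ((q : ℤ) ^ 12 ∣ W₀.Δ ∧ (q : ℤ) ^ 4 ∣ W₀.c₄) := by
  rintro q hq hq2 ⟨h12, h4⟩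
  have hqΔ : (q : ℤ) ∣ W₀.Δ := dvd_trans (dvd_pow_self _ (by norm_num)) h12
  obtain ⟨E, -, hE, rfl⟩ := mem_of_prime_dvd_kraus hc hq hq2 hqΔ
  simp only [OddEntry.minCheck, Bool.and_eq_true, Bool.or_eq_true, decide_eq_true_eq] at hE
  rcases hE.2 with hnd | ⟨he, hmin⟩
  · exact hnd (dvd_trans (dvd_pow_self _ (by norm_num)) h4)
  · rcases hmin with he12 | ⟨ht, ht4⟩
    · exact (exactPow_spec he).2 (dvd_trans (pow_dvd_pow _ (by omega : E.e + 1 ≤ 12)) h12)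
    · exact (exactPow_spec ht).2 (dvd_trans (pow_dvd_pow _ (by omega : E.t.toNat + 1 ≤ 4)) h4)

/-- **A Kraus certificate proves that `W₀ ⊗ ℚ` is a global minimal equation.**
[cite: Kraus1989, Prop. 2] -/
theorem isGloballyMinimal_of_krausCheck (hc : c.krausCheck W₀ = true) :
    (W₀.baseChange ℚ).IsGloballyMinimal := by
  have hodd := odd_criterion_of_krausCheck hc
  simp only [RNCert.krausCheck, Bool.and_eq_true, decide_eq_true_eq] at hc
  obtain ⟨⟨-, h4⟩, h6⟩ := hc
  obtain ⟨h4', h6'⟩ := kraus_two_of_natAbs W₀ h4 h6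
  exact isGloballyMinimal_baseChange_int_of_kraus₄ W₀ h4' h6' hodd

/-- A minimality-only certificate also proves global minimality of `W₀ ⊗ ℚ` (restated over the
integer model, for the total walker). [cite: SilvermanAEC2009, VII.1 Remark 1.1] -/
theorem isGloballyMinimal_baseChange_of_minCheck (hc : c.minCheck W₀ = true) :
    (W₀.baseChange ℚ).IsGloballyMinimal := by
  refine isGloballyMinimal_of_forall_isMinimalAt_int _ fun v => ?_
  rcases not_and_or.mp (int_criterion_of_minCheck hc _ (prime_natGenerator v)) with h | h
  · exact isMinimalAt_baseChange_int_of_not_pow_dvd_Δ h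
  · exact isMinimalAt_baseChange_int_of_not_pow_four_dvd_c₄ h

end IntModel

/-! ### Rows -/

/-- A row is KRAUS CERTIFIED if some certificate passes `krausCheck` on its integer model. [folklore] -/
def Rank3Row.KrausCertified (r : Rank3Row) : Prop := ∃ c : RNCert, c.krausCheck r.intModel = true

/-- **Cremona's equation of a `KrausCertified` row is a global minimal model** — no hypothesis.
[cite: Kraus1989, Prop. 2] -/
theorem Rank3Row.isGloballyMinimal_of_krausCertified {r : Rank3Row} (h : r.KrausCertified) :
    r.curve.IsGloballyMinimal := by
  obtain ⟨c, hc⟩ := h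
  rw [Rank3Row.curve_eq_baseChange]
  exact isGloballyMinimal_of_krausCheck hc

/-! ### The total one-pass walker -/

/-- Minimality check of ONE row from its aligned root-number certificate (must be `some c` with
`c.minCheck`). [folklore] -/
def rowMinOfOpt (r : Rank3Row) : Option RNCert → Bool
  | some c => c.minCheck r.intModel
  | none => false

/-- Soundness of `rowMinOfOpt`. [folklore] -/
theorem isGloballyMinimal_of_rowMinOfOpt {r : Rank3Row} {o : Option RNCert}
    (h : rowMinOfOpt r o = true) : r.curve.IsGloballyMinimal := by
  cases o with
  | none => simp [rowMinOfOpt] at h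
  | some c => exact Rank3Row.isGloballyMinimal_of_minCertified ⟨c, h⟩

/-- TOTAL one-pass minimality walker over a table `rows` with ALIGNED root-number certificates `os`
and ONE index-sorted list of extra certificates tagged `false` = minimality-only (`minCheck`) /
`true` = Kraus (`krausCheck`); a row not listed at its position `n` must carry a root-number
certificate passing `minCheck`. (All list arguments of the recursive calls are matched sublists, so
the kernel evaluation builds no nested state.) [folklore] -/
def totalMinCheck : List Rank3Row → List (Option RNCert) → ℕ → List (ℕ × Bool × RNCert) → Bool
  | [], _, _, _ => true
  | _ :: _, [], _, _ => false
  | r :: rs, o :: os, n, [] => rowMinOfOpt r o && totalMinCheck rs os (n + 1) []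
  | r :: rs, o :: os, n, (i, false, c) :: rest =>
      if i = n then c.minCheck r.intModel && totalMinCheck rs os (n + 1) rest
      else rowMinOfOpt r o && totalMinCheck rs os (n + 1) ((i, false, c) :: rest)
  | r :: rs, o :: os, n, (i, true, c) :: rest =>
      if i = n then c.krausCheck r.intModel && totalMinCheck rs os (n + 1) rest
      else rowMinOfOpt r o && totalMinCheck rs os (n + 1) ((i, true, c) :: rest)

/-- **Soundness of the total walker: every row of the table is a global minimal model.**
[cite: SilvermanAEC2009, VII.1 Remark 1.1] -/
theorem isGloballyMinimal_of_totalMinCheck :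
    ∀ (rows : List Rank3Row) (os : List (Option RNCert)) (n : ℕ) (xs : List (ℕ × Bool × RNCert)),
      totalMinCheck rows os n xs = true → ∀ r ∈ rows, r.curve.IsGloballyMinimal
  | [], _, _, _, _, r, hr => by simp at hr
  | _ :: _, [], _, _, h, _, _ => by simp [totalMinCheck] at h
  | r :: rs, o :: os, n, [], h, r', hr' => by
    simp only [totalMinCheck, Bool.and_eq_true] at h
    rcases List.mem_cons.mp hr' with rfl | hmem
    · exact isGloballyMinimal_of_rowMinOfOpt h.1
    · exact isGloballyMinimal_of_totalMinCheck rs os (n + 1) [] h.2 r' hmem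
  | r :: rs, o :: os, n, (i, false, c) :: rest, h, r', hr' => by
    by_cases hi : i = n
    · simp only [totalMinCheck, hi, ↓reduceIte, Bool.and_eq_true] at h
      rcases List.mem_cons.mp hr' with rfl | hmem
      · exact Rank3Row.isGloballyMinimal_of_minCertified ⟨c, h.1⟩
      · exact isGloballyMinimal_of_totalMinCheck rs os (n + 1) rest h.2 r' hmem
    · simp only [totalMinCheck, hi, ↓reduceIte, Bool.and_eq_true] at h
      rcases List.mem_cons.mp hr' with rfl | hmem
      · exact isGloballyMinimal_of_rowMinOfOpt h.1
      · exact isGloballyMinimal_of_totalMinCheck rs os (n + 1) _ h.2 r' hmem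
  | r :: rs, o :: os, n, (i, true, c) :: rest, h, r', hr' => by
    by_cases hi : i = n
    · simp only [totalMinCheck, hi, ↓reduceIte, Bool.and_eq_true] at h
      rcases List.mem_cons.mp hr' with rfl | hmem
      · exact Rank3Row.isGloballyMinimal_of_krausCertified ⟨c, h.1⟩
      · exact isGloballyMinimal_of_totalMinCheck rs os (n + 1) rest h.2 r' hmem
    · simp only [totalMinCheck, hi, ↓reduceIte, Bool.and_eq_true] at h
      rcases List.mem_cons.mp hr' with rfl | hmem
      · exact isGloballyMinimal_of_rowMinOfOpt h.1
      · exact isGloballyMinimal_of_totalMinCheck rs os (n + 1) _ h.2 r' hmem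

/-- Merge two index-sorted certificate lists into one tagged list (`false` = first list, `true` =
second), with structural fuel for kernel evaluation. [folklore] -/
def mergeIdx : ℕ → List (ℕ × RNCert) → List (ℕ × RNCert) → List (ℕ × Bool × RNCert)
  | 0, _, _ => []
  | _ + 1, [], [] => []
  | fuel + 1, [], (j, d) :: ks => (j, true, d) :: mergeIdx fuel [] ks
  | fuel + 1, (i, c) :: ms, [] => (i, false, c) :: mergeIdx fuel ms []
  | fuel + 1, (i, c) :: ms, (j, d) :: ks =>
      if i ≤ j then (i, false, c) :: mergeIdx fuel ms ((j, d) :: ks)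
      else (j, true, d) :: mergeIdx fuel ((i, c) :: ms) ks

/-- Self-test (kernel): row `28` (`27584bd1 = [0,0,0,-4,64]`: `2¹² ∣ Δ`, `2⁶ ∥ c₄`), Kraus
certificate `⟨12, 6, 11, [(431)]⟩`. [cite: CremonaAlgorithms1997, Tables] -/
example : RNCert.krausCheck (rank3Table[28]'(by rw [rank3Table_length]; norm_num)).intModel
    ⟨12, 6, 11, [⟨431, 20, 1, 0, 0⟩]⟩ = true := by
  decide +kernel

end Summit.BirchSwinnertonDyer.BirchSwinnertonDyer.Rank2Observatory
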